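import Literature.LinearAlgebra.Matrix.FiniteRangeDecompositionMatrix
import HarnessLib

/-!
# The finite-range decomposition of a positive quadratic form on a finite set, II:
# the pieces sum to the Green function — `Σ_{j≤N} C_j + C_N^♭ = Q⁺ + a·Π_{ker Q}`
# (Bauerschmidt 2013, Thm. 1.2; BBS Ch. 3, Proposition "Covariance decomposition")

Companion of `FiniteRangeDecompositionMatrix.lean` (the pieces `C_j = g_j(Q)`, their positivity,
symmetry and finite range).  Here: the scale integral of the kernel over ALL scales is the inverse,
`∫₀^∞ ŵ_Θ(t,μ) dt/t = 1/μ` for `μ ∈ (0,4Θ)` (BBS (3.17): "`1/(λ(k)+m²) = ∫₀^∞ ŵ(t,k) dt/t`"), the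
scale intervals `(s_{j-1},s_j]`, `j = 1,…,N`, and `(s_N,∞)` partition `(0,∞)`, and therefore, by the
functional calculus, for `Q ⪰ 0` with spectrum in `[0,2Θ]` and `L ≥ 1`,

  `Σ_{j=1}^{N} C_j + C_N^♭ = Q⁺ + a_N · Π₀`,   `a_N = Σ_{j=1}^N g_j(0) ≥ 0`,

where `Q⁺ = cfc (·⁻¹) Q` is the (Moore–Penrose) inverse of `Q` on `(ker Q)^⊥` and
`Π₀ = cfc 𝟙_{0} Q` the spectral projection onto `ker Q` — the massless (`m² = 0`) form of BBS's
"`(-Δ+m²)⁻¹ = Σ_j C_j`" on a finite set, where the zero modes of `Q` cannot be inverted: the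
finite-range pieces see the kernel only through the explicit constant `a_N`, which is invisible to
every functional of the field that is invariant under `ker Q` (for a form with `ker Q =` constants:
every functional of the increments).  For such forms `Π₀` is the averaging projection
`|ι|⁻¹ 𝟙𝟙ᵀ` (`cfc_indicator_eq_average`).

## Contents (everything is proved; no new definition)

* `integrableOn_mul_chebyProfile_Ioi`, `integrableOn_wFun_div_Ioi`, **`integral_wFun_div_Ioi`** —
  `∫₀^∞ ŵ_Θ(t,μ)dt/t = μ⁻¹` for `0 < μ < 4Θ`;
* `sum_setIntegral_scaleEnd` — additivity of `∫₀^∞` over the scale partition;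
  **`sum_gFun_add_gTop`** — `Σ_{j≤N} g_j(μ) + g_N^♭(μ) = μ⁻¹` (`μ ≠ 0` in the window) and `= a_N`
  at `μ = 0`;
* **`sum_piece_add_top`** — the decomposition identity displayed above;
* `mul_cfc_inv`, `cfc_inv_mul`, `mul_cfc_indicator`, `cfc_indicator_mul`,
  `cfc_indicator_mul_self`, `cfc_indicator_mulVec_of_mulVec_eq_zero` — `Q Q⁺ = Q⁺ Q = 1 - Π₀`,
  `Q Π₀ = Π₀ Q = 0`, `Π₀² = Π₀`, `Π₀ v = v` on `ker Q`;
* **`cfc_indicator_eq_average`** — if `ker Q` consists of the constant vectors, then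
  `Π₀ = |ι|⁻¹ 𝟙𝟙ᵀ`.

## References

* R. Bauerschmidt, PTRF 157 (2013) 817–845, Thm. 1.2. [Bauerschmidt2013]
* R. Bauerschmidt, D. C. Brydges, G. Slade, LNM 2242 (2019), Ch. 3, Proposition "Covariance
  decomposition" and (3.17). [BauerschmidtBrydgesSlade2019RG]
-/

noncomputable section

open Matrix Polynomial MeasureTheory Set
open scoped MatrixOrder ComplexOrder Real
open Literature.Barriers.CriticalPhenomena.LongRangePhi4

namespace Literature.LinearAlgebra.Matrix

namespace MatrixFRD

variable {𝕜 : Type*} [RCLike 𝕜] {ι : Type*} [Fintype ι] [DecidableEq ι]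

/-! ### The integral over all scales -/

omit [Fintype ι] [DecidableEq ι] in
/-- `t ↦ t P_t(ζ)` is integrable on `(0,∞)` for `ζ ∈ (0,4)` (its integral is `c/ζ ≠ 0`).
[cite: BauerschmidtBrydgesSlade2019RG, Ch. 3, "Finite-range decomposition: lattice" (second lemma of "Integral decomposition")] -/
theorem integrableOn_mul_chebyProfile_Ioi {ζ : ℝ} (h0 : 0 < ζ) (h4 : ζ < 4) :
    IntegrableOn (fun t => t * FRD.chebyProfile (fun v => (FRD.profile v).re) t ζ) (Ioi 0) := by
  by_contra h
  have h0' := integral_undef h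
  rw [FRD.integral_mul_chebyProfile_profile h0 h4] at h0'
  exact (div_pos FRD.cProfile_pos h0).ne' h0'

omit [Fintype ι] [DecidableEq ι] in
/-- `t ↦ ŵ_Θ(t,μ)/t` is integrable on `(0,∞)` for `0 < μ < 4Θ`. [folklore] -/
theorem integrableOn_wFun_div_Ioi {Θ : ℝ} (hΘ : 0 < Θ) {μ : ℝ} (h0 : 0 < μ) (h4 : μ < 4 * Θ)
    {a : ℝ} (ha : 0 ≤ a) : IntegrableOn (fun t => wFun Θ t μ / t) (Ioi a) := by
  have hζ0 : 0 < μ / Θ := div_pos h0 hΘ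
  have hζ4 : μ / Θ < 4 := by rw [div_lt_iff₀ hΘ]; linarith
  have h : IntegrableOn (fun t => (FRD.cProfile * Θ)⁻¹ *
      (t * FRD.chebyProfile (fun v => (FRD.profile v).re) t (μ / Θ))) (Ioi a) :=
    ((integrableOn_mul_chebyProfile_Ioi hζ0 hζ4).mono_set (Ioi_subset_Ioi ha)).const_mul
      (FRD.cProfile * Θ)⁻¹
  refine h.congr_fun (fun t ht => ?_) measurableSet_Ioi
  have htne : t ≠ 0 := (ha.trans_lt ht).ne'
  unfold wFun
  field_simp

omit [Fintype ι] [DecidableEq ι] in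
/-- **The integral over all scales is the inverse**: `∫₀^∞ ŵ_Θ(t,μ) dt/t = 1/μ` for
`0 < μ < 4Θ` — BBS (3.17) "`1/(λ(k)+m²) = ∫₀^∞ ŵ(t,k) dt/t`" in the spectral variable.
[cite: BauerschmidtBrydgesSlade2019RG, Ch. 3, "Finite-range decomposition: lattice" (display (3.17))] -/
theorem integral_wFun_div_Ioi {Θ : ℝ} (hΘ : 0 < Θ) {μ : ℝ} (h0 : 0 < μ) (h4 : μ < 4 * Θ) :
    ∫ t in Ioi 0, wFun Θ t μ / t = μ⁻¹ := by
  have hζ0 : 0 < μ / Θ := div_pos h0 hΘ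
  have hζ4 : μ / Θ < 4 := by rw [div_lt_iff₀ hΘ]; linarith
  have hc := FRD.cProfile_pos
  calc ∫ t in Ioi 0, wFun Θ t μ / t
      = ∫ t in Ioi 0, (FRD.cProfile * Θ)⁻¹ *
          (t * FRD.chebyProfile (fun v => (FRD.profile v).re) t (μ / Θ)) := by
        refine setIntegral_congr_fun measurableSet_Ioi fun t ht => ?_
        have htne : t ≠ 0 := (ne_of_gt ht)
        unfold wFun
        field_simp
    _ = (FRD.cProfile * Θ)⁻¹ * (FRD.cProfile / (μ / Θ)) := by
        rw [integral_const_mul, FRD.integral_mul_chebyProfile_profile hζ0 hζ4]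
        rfl
    _ = μ⁻¹ := by
        field_simp

/-! ### The scale partition -/

omit [Fintype ι] [DecidableEq ι] in
/-- **Additivity over the scale partition**: for `L ≥ 1` and `h` integrable on `(0,∞)`,
`Σ_{j=1}^{N} ∫_{(s_{j-1},s_j]} h + ∫_{(s_N,∞)} h = ∫_{(0,∞)} h`. [folklore] -/
theorem sum_setIntegral_scaleEnd {L : ℝ} (hL : 1 ≤ L) {h : ℝ → ℝ} (hh : IntegrableOn h (Ioi 0))
    (N : ℕ) :
    (∑ j ∈ Finset.Icc 1 N, (∫ t in Ioc (scaleEnd L (j - 1)) (scaleEnd L j), h t)) +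
      (∫ t in Ioi (scaleEnd L N), h t) = ∫ t in Ioi 0, h t := by
  have hL0 : 0 ≤ L := by linarith
  induction N with
  | zero =>
      rw [Finset.Icc_eq_empty (by omega), Finset.sum_empty, zero_add, scaleEnd_zero]
  | succ N ih =>
      rw [Finset.sum_Icc_succ_top (by omega), Nat.add_sub_cancel, ← ih, add_assoc]
      congr 1
      have hle : scaleEnd L N ≤ scaleEnd L (N + 1) := scaleEnd_le_succ hL N
      rw [← setIntegral_union Ioc_disjoint_Ioi_same measurableSet_Ioi
        (hh.mono_set fun t ht => (scaleEnd_nonneg hL0 N).trans_lt ht.1)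
        (hh.mono_set (Ioi_subset_Ioi (scaleEnd_nonneg hL0 _))), Ioc_union_Ioi_eq_Ioi hle]

omit [Fintype ι] [DecidableEq ι] in
/-- **The scale functions sum to the inverse**: for `L ≥ 1` and `0 < μ < 4Θ`,
`Σ_{j=1}^N g_j(μ) + g_N^♭(μ) = μ⁻¹`. [cite: Bauerschmidt2013, Thm. 1.2 (the pieces sum to the Green function)] -/
theorem sum_gFun_add_gTop_of_pos {Θ : ℝ} (hΘ : 0 < Θ) {L : ℝ} (hL : 1 ≤ L) {μ : ℝ} (h0 : 0 < μ)
    (h4 : μ < 4 * Θ) (N : ℕ) :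
    (∑ j ∈ Finset.Icc 1 N, gFun Θ L j μ) + gTop Θ L N μ = μ⁻¹ := by
  unfold gFun gTop
  rw [if_neg h0.ne', sum_setIntegral_scaleEnd hL (integrableOn_wFun_div_Ioi hΘ h0 h4 le_rfl) N,
    integral_wFun_div_Ioi hΘ h0 h4]

omit [Fintype ι] [DecidableEq ι] in
/-- At the zero mode the scale functions sum to the constant `a_N = Σ_{j≤N} g_j(0)` (the top
function vanishes there by definition). [folklore] -/
theorem sum_gFun_add_gTop_zero (Θ L : ℝ) (N : ℕ) :
    (∑ j ∈ Finset.Icc 1 N, gFun Θ L j 0) + gTop Θ L N 0 = ∑ j ∈ Finset.Icc 1 N, gFun Θ L j 0 := by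
  simp [gTop]

/-! ### The decomposition identity -/

/-- **THE DECOMPOSITION IDENTITY** (Bauerschmidt 2013, Thm. 1.2; BBS, Proposition "Covariance
decomposition", massless form on a finite set).  For `Q ⪰ 0` with spectrum in `[0,2Θ]`, `Θ > 0`,
`L ≥ 1` and every `N`,

  `Σ_{j=1}^{N} C_j + C_N^♭ = Q⁺ + a_N · Π₀`,

`Q⁺ = cfc (·⁻¹) Q` the inverse of `Q` on `(ker Q)^⊥`, `Π₀ = cfc 𝟙_{0} Q` the projection onto
`ker Q`, `a_N = Σ_{j≤N} g_j(0)`. [cite: Bauerschmidt2013, Thm. 1.2 (the pieces sum to the Green function)] -/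
theorem sum_piece_add_top {Q : Matrix ι ι 𝕜} (hQ : Q.PosSemidef) {Θ : ℝ} (hΘ : 0 < Θ)
    (hsp : ∀ μ ∈ spectrum ℝ Q, μ ≤ 2 * Θ) {L : ℝ} (hL : 1 ≤ L) (N : ℕ) :
    (∑ j ∈ Finset.Icc 1 N, piece Q Θ L j) + top Q Θ L N =
      cfc (fun μ : ℝ => μ⁻¹) Q +
        (∑ j ∈ Finset.Icc 1 N, gFun Θ L j 0) • cfc (fun μ : ℝ => if μ = 0 then 1 else 0) Q := by
  unfold piece top
  rw [← cfc_sum (fun j => gFun Θ L j) Q _ (fun j _ => cfc_continuousOn Q _),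
    ← cfc_add (hf := cfc_continuousOn Q _) (hg := cfc_continuousOn Q _),
    ← cfc_smul (hf := cfc_continuousOn Q _),
    ← cfc_add (hf := cfc_continuousOn Q _) (hg := cfc_continuousOn Q _)]
  refine cfc_congr fun μ hμ => ?_
  have h0 := spectrum_nonneg_of_posSemidef hQ μ hμ
  simp only [Finset.sum_apply, smul_eq_mul]
  rcases h0.lt_or_eq with hpos | hzero
  · rw [sum_gFun_add_gTop_of_pos hΘ hL hpos (by linarith [hsp μ hμ]) N, if_neg hpos.ne',
      mul_zero, add_zero]
  · rw [← hzero, sum_gFun_add_gTop_zero, if_pos rfl, _root_.inv_zero, zero_add, mul_one]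

/-! ### The inverse on `(ker Q)^⊥` and the kernel projection -/

/-- `Q Q⁺ = 1 - Π₀`. [folklore] -/
theorem mul_cfc_inv {Q : Matrix ι ι 𝕜} (hQ : Q.IsHermitian) :
    Q * cfc (fun μ : ℝ => μ⁻¹) Q = 1 - cfc (fun μ : ℝ => if μ = 0 then 1 else 0) Q := by
  have hQ' : IsSelfAdjoint Q := hQ
  have hid : cfc (fun μ : ℝ => μ) Q = Q := cfc_id' ℝ Q hQ'
  calc Q * cfc (fun μ : ℝ => μ⁻¹) Q = cfc (fun μ : ℝ => μ) Q * cfc (fun μ : ℝ => μ⁻¹) Q := by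
        rw [hid]
    _ = cfc (fun μ : ℝ => μ * μ⁻¹) Q :=
        (cfc_mul _ _ Q (cfc_continuousOn Q _) (cfc_continuousOn Q _)).symm
    _ = cfc (fun μ : ℝ => 1 - (if μ = 0 then 1 else 0)) Q := by
        refine cfc_congr fun μ _ => ?_
        by_cases h : μ = 0
        · simp [h]
        · simp [h]
    _ = _ := by
        rw [cfc_sub (hf := cfc_continuousOn Q _) (hg := cfc_continuousOn Q _), cfc_const_one ℝ Q hQ']

/-- `Q⁺ Q = 1 - Π₀`. [folklore] -/
theorem cfc_inv_mul {Q : Matrix ι ι 𝕜} (hQ : Q.IsHermitian) :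
    cfc (fun μ : ℝ => μ⁻¹) Q * Q = 1 - cfc (fun μ : ℝ => if μ = 0 then 1 else 0) Q := by
  rw [← mul_cfc_inv hQ]
  exact ((commute_cfc_of_commute (Commute.refl Q) _).symm).eq.symm

/-- `Q Π₀ = 0`. [folklore] -/
theorem mul_cfc_indicator {Q : Matrix ι ι 𝕜} (hQ : Q.IsHermitian) :
    Q * cfc (fun μ : ℝ => if μ = 0 then 1 else 0) Q = 0 := by
  have hQ' : IsSelfAdjoint Q := hQ
  have hid : cfc (fun μ : ℝ => μ) Q = Q := cfc_id' ℝ Q hQ'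
  calc Q * cfc (fun μ : ℝ => if μ = 0 then 1 else 0) Q
      = cfc (fun μ : ℝ => μ) Q * cfc (fun μ : ℝ => if μ = 0 then 1 else 0) Q := by rw [hid]
    _ = cfc (fun μ : ℝ => μ * (if μ = 0 then 1 else 0)) Q :=
        (cfc_mul _ _ Q (cfc_continuousOn Q _) (cfc_continuousOn Q _)).symm
    _ = cfc (fun _ : ℝ => (0 : ℝ)) Q := by
        refine cfc_congr fun μ _ => ?_
        by_cases h : μ = 0
        · simp [h]
        · simp [h]
    _ = 0 := cfc_const_zero ℝ Q

/-- `Π₀ Q = 0`. [folklore] -/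
theorem cfc_indicator_mul {Q : Matrix ι ι 𝕜} (hQ : Q.IsHermitian) :
    cfc (fun μ : ℝ => if μ = 0 then 1 else 0) Q * Q = 0 := by
  rw [(commute_cfc_of_commute (Commute.refl Q) _).eq, mul_cfc_indicator hQ]

/-- `Π₀² = Π₀`. [folklore] -/
theorem cfc_indicator_mul_self (Q : Matrix ι ι 𝕜) :
    cfc (fun μ : ℝ => if μ = 0 then 1 else 0) Q * cfc (fun μ : ℝ => if μ = 0 then 1 else 0) Q =
      cfc (fun μ : ℝ => if μ = 0 then 1 else 0) Q := by
  rw [← cfc_mul _ _ Q (cfc_continuousOn Q _) (cfc_continuousOn Q _)]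
  refine cfc_congr fun μ _ => ?_
  by_cases h : μ = 0
  · simp [h]
  · simp [h]

/-- **`Π₀` fixes the kernel**: `Q v = 0 ⇒ Π₀ v = v`. [folklore] -/
theorem cfc_indicator_mulVec_of_mulVec_eq_zero {Q : Matrix ι ι 𝕜} (hQ : Q.IsHermitian)
    {v : ι → 𝕜} (hv : Q *ᵥ v = 0) :
    cfc (fun μ : ℝ => if μ = 0 then 1 else 0) Q *ᵥ v = v := by
  have h := cfc_inv_mul hQ
  rw [eq_sub_iff_add_eq] at h
  have := congrArg (fun M : Matrix ι ι 𝕜 => M *ᵥ v) h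
  simpa [Matrix.add_mulVec, ← Matrix.mulVec_mulVec, hv] using this

/-- **The kernel projection of a form whose kernel is the constants is the averaging
projection**: if `Q 𝟙 = 0` and every `v` with `Q v = 0` is constant, then
`Π₀ = |ι|⁻¹ 𝟙𝟙ᵀ`.  (Used for translation-invariant forms dominating a connected Laplacian: the
non-finite-range part `a_N Π₀` of the decomposition is a constant matrix, invisible to increments.)
[folklore] -/
theorem cfc_indicator_eq_average [Nonempty ι] {Q : Matrix ι ι 𝕜} (hQ : Q.IsHermitian)
    (h1 : Q *ᵥ (fun _ => (1 : 𝕜)) = 0)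
    (hker : ∀ v : ι → 𝕜, Q *ᵥ v = 0 → ∃ c : 𝕜, v = fun _ => c) :
    cfc (fun μ : ℝ => if μ = 0 then 1 else 0) Q =
      ((Fintype.card ι : 𝕜)⁻¹) • Matrix.of (fun _ _ : ι => (1 : 𝕜)) := by
  set Pz : Matrix ι ι 𝕜 := cfc (fun μ : ℝ => if μ = 0 then 1 else 0) Q with hPz
  set P : Matrix ι ι 𝕜 := ((Fintype.card ι : 𝕜)⁻¹) • Matrix.of (fun _ _ : ι => (1 : 𝕜)) with hP
  have hcard : (Fintype.card ι : 𝕜) ≠ 0 := Nat.cast_ne_zero.mpr Fintype.card_ne_zero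
  -- (1) `P Q = 0`
  have hPQ : P * Q = 0 := by
    ext x y
    rw [hP, Matrix.smul_mul, Matrix.smul_apply, Matrix.mul_apply, Matrix.zero_apply]
    have hsum : ∑ z, Matrix.of (fun _ _ : ι => (1 : 𝕜)) x z * Q z y = star ((Q *ᵥ fun _ => (1 : 𝕜)) y) := by
      simp only [Matrix.of_apply, one_mul, Matrix.mulVec, dotProduct, mul_one, star_sum]
      refine Finset.sum_congr rfl fun z _ => ?_
      exact (hQ.apply z y).symm
    rw [hsum, h1, Pi.zero_apply, star_zero, smul_zero]
  -- (2) columns of `Pz` are constant: `Pz x y = Pz x' y`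
  have hcol : ∀ y, ∃ c : 𝕜, ∀ x, Pz x y = c := by
    intro y
    have hQPz : Q *ᵥ (fun x => Pz x y) = 0 := by
      funext x
      have := congrFun (congrFun (mul_cfc_indicator hQ) x) y
      simpa [Matrix.mul_apply, Matrix.mulVec, dotProduct] using this
    obtain ⟨c, hc⟩ := hker _ hQPz
    exact ⟨c, fun x => congrFun hc x⟩
  -- (3) `D 𝟙 = 0` for `D = Pz - P`
  have hPz1 : Pz *ᵥ (fun _ => (1 : 𝕜)) = fun _ => 1 :=
    cfc_indicator_mulVec_of_mulVec_eq_zero hQ h1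
  have hP1 : P *ᵥ (fun _ => (1 : 𝕜)) = fun _ => 1 := by
    funext x
    simp [hP, Matrix.mulVec, dotProduct, Finset.card_univ, hcard]
  -- (4) `D = D (Q Q⁺ + Pz) = (D Q) Q⁺ + D Pz = 0`
  have hdecomp : Q * cfc (fun μ : ℝ => μ⁻¹) Q + Pz = 1 := by
    rw [mul_cfc_inv hQ, sub_add_cancel]
  have hDQ : (Pz - P) * Q = 0 := by rw [Matrix.sub_mul, cfc_indicator_mul hQ, hPQ, sub_zero]
  have hDPz : (Pz - P) * Pz = 0 := by
    ext x y
    obtain ⟨c, hc⟩ := hcol y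
    rw [Matrix.mul_apply, Matrix.zero_apply]
    simp_rw [hc]
    rw [← Finset.sum_mul]
    have h0 : ∑ z, (Pz - P) x z = ((Pz - P) *ᵥ fun _ => (1 : 𝕜)) x := by
      simp [Matrix.mulVec, dotProduct]
    rw [h0, Matrix.sub_mulVec, hPz1, hP1, sub_self, Pi.zero_apply, zero_mul]
  have hD : Pz - P = 0 := by
    calc Pz - P = (Pz - P) * (Q * cfc (fun μ : ℝ => μ⁻¹) Q + Pz) := by rw [hdecomp, Matrix.mul_one]
      _ = 0 := by rw [Matrix.mul_add, ← Matrix.mul_assoc, hDQ, Matrix.zero_mul, hDPz, add_zero]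
  exact sub_eq_zero.mp hD

end MatrixFRD

end Literature.LinearAlgebra.Matrix

end
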